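import Summits.QuantumFields.YangMills.Theorems.UnitScaleTiltProp7CovariantLocalHolderTorus
import Summits.QuantumFields.YangMills.Theorems.UnitScaleTiltProp7KatoBootstrapMember
import Summits.QuantumFields.YangMills.Theorems.UnitScaleTiltProp7TwoBackgroundGradientComparison
import Summits.QuantumFields.YangMills.Theorems.UnitScaleTiltProp7FlatMemberLocalGradient
import HarnessLib

/-!
# Route `UnitScaleTilt`, crux K1 «MinimiserStabilityRegPr» (stmt-QuantumFields-19200), EX row (5) `h3` (STOREY H), H2 pipeline (ii) — programme **H2-LOC**, brick **(C5b):
# THE LETTER `hHlocV` DISCHARGED** — the curved interior η-½-Hölder estimate AT THE T³ MEMBER, in the FROZEN TEXT of record (★★OWNER RULING №52 (a), RECORD 17dq;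
# HOME `ym3-torus-px19/g16/H2LOC-LETTER-hHlocV.px19g16.txt` sha16 857ccd79b0071bdc): `∃ Ch θ₀, 0 ≤ Ch ∧ 0 < θ₀ ∧ ⟨hHlocV Ch θ₀⟩`.  The member dictionary onto (C5a)
# ✓`Prop7CovariantLocalHolderTorus.exists_covariant_localHolder_torus`: periods `periodsT3 F K`, scale `ℓ = L^{K−n}` (`η⁻¹ = ℓ`, ✓`inv_eta_cast`), transporters `adBg F K V`∕`adBgInv F K V`
# (unitary pair: ✓`adBgInv_adBg`, ✓`adW_adW_inv`, ✓`norm_adBg_eq`), fibre `W₂ = EuclideanSpace ℂ (Fin 2 × Fin 2)`, transporter smallness `2√2·δ` from the letter's bond row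
# `‖V(y,μ) − 1‖ ≤ δ` (✓`norm_adBg_sub_self_le`), `θ₀ := θ∕(2√2)`.

Cell `ym3-torus` (HUMAN RULING D-0037; rung R3 = SU(2) YM₃ on T³ — NOT d = 4, NOT infinite volume, NOT a mass gap, NOT Clay).  Width seat `ym3-torus-px19` (gen 16);
`--supports stmt-QuantumFields-19200 --as helper`; count-neutral; THEOREMS ONLY (0 `def`, 0 `sorry`, default heartbeats).

WHAT IS PROVED (ns `Summit.QuantumFields.YangMills.Theorems.Prop7CurvedMemberLocalHolder`).
* `adBg_adBgInv` (`R(V(b))(R(V(b))⁻¹w) = w`), `norm_adBg_sub_self_le_of_bond` (the letter's bond row ⟹ the transporter row with `2√2·δ`).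
* ★★★ `exists_hHlocV` — **`∃ Ch θ₀ : ℝ, 0 ≤ Ch ∧ 0 < θ₀ ∧` the text `hHlocV Ch θ₀` VERBATIM** (binders `F n K c₀ V u q f x Mu Mf Mq δ`, `ℓδ ≤ θ₀`, `covLapSite F n K c₀ V u + q = DstarL2 F n K c₀ V f`, the three
  sups and the bond row on `tdist x · ≤ 4ℓ+1`, conclusion `‖u x′ − u x‖ ≤ Ch·(Mu + Mf + Mq)·(tdist x x′∕ℓ)^{½}` for `tdist x x′ ≤ ℓ`).  The flat case was ✓p761993 `exists_localHolder_flat_member`;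
  this is the curved twin the H-road's Hölder storey consumes (C6: px13 g17's knit; `hWsup` door: px5 g16∕cst-p1 g38).
HYP-SAT (★★OWNER RULING №42): the theorem HAS NO displayed letter — it IS the supplier of the displayed letter `hHlocV`; its internal hypotheses are the letter's binders.
HONEST SCOPE: this closes `hHlocV` (857ccd79) by kernel; `hWsup`, H2 FILE 2 (C6), `h3`, norm_G, EX, 19200 and the rung are NOT proved here; the Yang–Mills mass gap is NOT proved.

References: T. Bałaban, CMP **99** (1985) 389–434 [Balaban1985BackgroundPropagators] (Thm 3.1 (3.43) p.398, (3.3) p.391, (3.8) p.392, (3.23) p.394, (3.35) p.396); CMP **96** (1984) 223–250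
[Balaban1984PropagatorsII] ((1.9) p.226); CMP **98** (1985) 17–51 [Balaban1985Averaging] ((18)–(20) p.21); M. Giaquinta, *Multiple integrals …* (1983) [Giaquinta1984] (Ch. III §2 Thm 2.2).
-/

set_option autoImplicit false

noncomputable section

open scoped InnerProductSpace ComplexConjugate BigOperators Matrix.Norms.L2Operator

namespace Summit.QuantumFields.YangMills.Theorems.Prop7CurvedMemberLocalHolder

open Literature.MathematicalPhysics.QuantumFieldTheory.Balaban1983to89
open Literature.MathematicalPhysics.QuantumFieldTheory.Balaban1983to89.T3ContinuumYM3Torus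
open B4Sect5Torus (TSite tdist)
open B9SectCLatticeCarrier (Bond)
open B9Eq311L2Pairing (WL2)
open B11Eq103H1Complex (SiteL2K BondL2K covDivL2K covLaplaceSiteK)
open T3SectALandauChart (eta eta_pos)
open Summit.QuantumFields.YangMills.Theorems.Prop7SectET3Transport (periodsT3 bgOfCfg isUnitaryBg_bgOfCfg)
open Summit.QuantumFields.YangMills.Theorems.Prop7SectET3HilbertLetters (W₂ adW adBg adBgInv DstarL2 covLapSite covLapSite_eq)
open Summit.QuantumFields.YangMills.Theorems.PoincareLipschitzCovariantBridge (adW_adW_inv)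
open Summit.QuantumFields.YangMills.Theorems.Prop7KatoBootstrapMember (norm_adBg_eq adBgInv_adBg)
open Summit.QuantumFields.YangMills.Theorems.Prop7TwoBackgroundGradientComparison (norm_adBg_sub_self_le)
open Summit.QuantumFields.YangMills.Theorems.Prop7FlatMemberLocalGradient (inv_eta_cast ell_cast one_le_ell)
open Summit.QuantumFields.YangMills.Theorems.Prop7CovariantLocalHolderTorus (exists_covariant_localHolder_torus)

/-- `R(V(b))(R(V(b))⁻¹ w) = w` at the member (`adW_adW_inv`). [folklore] [cite: Balaban1985BackgroundPropagators, (3.3) p.391, (3.8) p.392] -/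
theorem adBg_adBgInv (F : T3Family) (K : ℕ) (V : GaugeField (F.P K) 0 (Matrix.specialUnitaryGroup (Fin 2) ℂ)) (b : Bond 3 (periodsT3 F K)) (w : W₂) :
    adBg F K V b (adBgInv F K V b w) = w :=
  adW_adW_inv _ w

/-- The letter's bond row gives the transporter row: `‖V(y,μ) − 1‖ ≤ δ ⟹ ‖Ad(V(y,μ))w − w‖ ≤ (2√2·δ)‖w‖`. [cite: Balaban1985Averaging, (18)–(20) p.21] -/
theorem norm_adBg_sub_self_le_of_bond (F : T3Family) (K : ℕ) (V : GaugeField (F.P K) 0 (Matrix.specialUnitaryGroup (Fin 2) ℂ)) (b : Bond 3 (periodsT3 F K)) {δ : ℝ}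
    (hδ : ‖((bgOfCfg F K V b : (Matrix (Fin 2) (Fin 2) ℂ)ˣ) : Matrix (Fin 2) (Fin 2) ℂ) - 1‖ ≤ δ) (w : W₂) :
    ‖adBg F K V b w - w‖ ≤ (2 * Real.sqrt 2 * δ) * ‖w‖ := by
  have h := norm_adBg_sub_self_le F K V b w
  have h2 : 2 * Real.sqrt 2 * ‖((bgOfCfg F K V b : (Matrix (Fin 2) (Fin 2) ℂ)ˣ) : Matrix (Fin 2) (Fin 2) ℂ) - 1‖ * ‖w‖ ≤ 2 * Real.sqrt 2 * δ * ‖w‖ :=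
    mul_le_mul_of_nonneg_right (mul_le_mul_of_nonneg_left hδ (by positivity)) (norm_nonneg _)
  exact h.trans h2

/-- ★★★ **`hHlocV` DISCHARGED — THE CURVED INTERIOR η-½-HÖLDER ESTIMATE AT THE T³ MEMBER** ([Balaban1985BackgroundPropagators] Thm 3.1 (3.43) in LOCAL form at a curved background; the
frozen letter text 857ccd79 VERBATIM after `∃ Ch θ₀, 0 ≤ Ch ∧ 0 < θ₀ ∧`).  PROOF: (C5a) ✓`exists_covariant_localHolder_torus` at the member dictionary.
[cite: Balaban1985BackgroundPropagators, Thm 3.1 (3.43) p.398, (3.23) p.394, (3.35) p.396; Balaban1984PropagatorsII, (1.9) p.226; Giaquinta1984, Ch. III §2 Thm 2.2 pp.78–79] -/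
theorem exists_hHlocV : ∃ Ch θ₀ : ℝ, 0 ≤ Ch ∧ 0 < θ₀ ∧
    (∀ (F : T3Family) (n K : ℕ) (c₀ : ℝ) [Fact (0 < c₀)] (V : GaugeField (F.P K) 0 (Matrix.specialUnitaryGroup (Fin 2) ℂ))
      (u q : SiteL2K ℂ 3 (periodsT3 F K) c₀ W₂) (f : BondL2K ℂ 3 (periodsT3 F K) c₀ W₂) (x : TSite 3 (periodsT3 F K)) (Mu Mf Mq δ : ℝ),
      0 ≤ Mu → 0 ≤ Mf → 0 ≤ Mq → 0 ≤ δ → (F.L : ℝ) ^ (K - n) * δ ≤ θ₀ →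
      covLapSite F n K c₀ V u + q = DstarL2 F n K c₀ V f →
      (∀ y, tdist (periodsT3 F K) x y ≤ 4 * (F.L : ℝ) ^ (K - n) + 1 → ‖WL2.equiv ℂ (fun _ : TSite 3 (periodsT3 F K) => c₀) W₂ u y‖ ≤ Mu) →
      (∀ (y : TSite 3 (periodsT3 F K)) (μ : Fin 3), tdist (periodsT3 F K) x y ≤ 4 * (F.L : ℝ) ^ (K - n) + 1 →
        ‖WL2.equiv ℂ (fun _ : Bond 3 (periodsT3 F K) => c₀) W₂ f (y, μ)‖ ≤ Mf) →
      (∀ y, tdist (periodsT3 F K) x y ≤ 4 * (F.L : ℝ) ^ (K - n) + 1 → ‖WL2.equiv ℂ (fun _ : TSite 3 (periodsT3 F K) => c₀) W₂ q y‖ ≤ Mq) →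
      (∀ (y : TSite 3 (periodsT3 F K)) (μ : Fin 3), tdist (periodsT3 F K) x y ≤ 4 * (F.L : ℝ) ^ (K - n) + 1 →
        ‖((bgOfCfg F K V (y, μ) : (Matrix (Fin 2) (Fin 2) ℂ)ˣ) : Matrix (Fin 2) (Fin 2) ℂ) - 1‖ ≤ δ) →
      ∀ x' : TSite 3 (periodsT3 F K), tdist (periodsT3 F K) x x' ≤ (F.L : ℝ) ^ (K - n) →
        ‖WL2.equiv ℂ (fun _ : TSite 3 (periodsT3 F K) => c₀) W₂ u x' - WL2.equiv ℂ (fun _ : TSite 3 (periodsT3 F K) => c₀) W₂ u x‖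
          ≤ Ch * (Mu + Mf + Mq) * (tdist (periodsT3 F K) x x' / ((F.L : ℝ) ^ (K - n))) ^ ((1 : ℝ) / 2)) := by
  obtain ⟨C, θ, hC, hθ, hT⟩ := exists_covariant_localHolder_torus (ι := Fin 2 × Fin 2) (d := 3) (by norm_num)
  refine ⟨C, θ / (2 * Real.sqrt 2), hC, by positivity, ?_⟩
  intro F n K c₀ _ V u q f x Mu Mf Mq δ hMu hMf hMq hδ hℓδ hEq hbu hbf hbq hbV x' hxx'
  have h22 : (0 : ℝ) < 2 * Real.sqrt 2 := by positivity
  -- the scale `ℓ = L^{K−n}` as a natural number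
  set ℓ : ℕ := F.L ^ (K - n) with hℓdef
  have hℓ1 : 1 ≤ ℓ := one_le_ell F n K
  have hℓR : ((ℓ : ℕ) : ℝ) = (F.L : ℝ) ^ (K - n) := ell_cast F n K
  -- the equation in (C5a)'s currency
  have hEq' : covLaplaceSiteK (((ℓ : ℝ) : ℂ)) (adBg F K V) (adBgInv F K V) u + q = covDivL2K ℂ c₀ (((ℓ : ℝ) : ℂ)) (adBgInv F K V) f := by
    have e1 : (((eta F n K : ℝ) : ℂ))⁻¹ = ((ℓ : ℝ) : ℂ) := by rw [inv_eta_cast]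
    have h1 := hEq
    rw [covLapSite_eq, e1] at h1
    have e2 : DstarL2 F n K c₀ V f = covDivL2K ℂ c₀ (((ℓ : ℝ) : ℂ)) (adBgInv F K V) f := by
      show covDivL2K ℂ c₀ (((eta F n K : ℝ) : ℂ)⁻¹) (adBgInv F K V) f = _; rw [e1]
    rw [e2] at h1
    exact h1
  -- the transporter rows
  have hδ' : 0 ≤ 2 * Real.sqrt 2 * δ := by positivity
  have hℓδ' : (ℓ : ℝ) * (2 * Real.sqrt 2 * δ) ≤ θ := by
    rw [hℓR]
    have := mul_le_mul_of_nonneg_left hℓδ h22.le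
    calc (F.L : ℝ) ^ (K - n) * (2 * Real.sqrt 2 * δ) = 2 * Real.sqrt 2 * ((F.L : ℝ) ^ (K - n) * δ) := by ring
      _ ≤ 2 * Real.sqrt 2 * (θ / (2 * Real.sqrt 2)) := this
      _ = θ := by field_simp
  have hmain := hT (periodsT3 F K) ℓ hℓ1 c₀ (adBg F K V) (adBgInv F K V) (fun b w => adBgInv_adBg (F := F) (K := K) V b w) (fun b w => adBg_adBgInv F K V b w) (fun b w => norm_adBg_eq (F := F) (K := K) V b w)
    u q f x Mu Mf Mq (2 * Real.sqrt 2 * δ) hMu hMf hMq hδ' hℓδ' hEq'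
    (fun y hy => hbu y (by rw [hℓR] at hy; exact hy)) (fun y μ hy => hbf y μ (by rw [hℓR] at hy; exact hy)) (fun y hy => hbq y (by rw [hℓR] at hy; exact hy))
    (fun y μ w hy => norm_adBg_sub_self_le_of_bond F K V (y, μ) (hbV y μ (by rw [hℓR] at hy; exact hy)) w) x' (by rw [hℓR]; exact hxx')
  rw [hℓR] at hmain
  exact hmain

end Summit.QuantumFields.YangMills.Theorems.Prop7CurvedMemberLocalHolder

end
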